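import Mathlib
import Literature.NumberTheory.LFunctions.Zhang2022.Section13ZeroSumsL23
import Literature.NumberTheory.LFunctions.Zhang2022.Section13ZeroSumsL
import Literature.NumberTheory.LFunctions.Zhang2022.Section13MeanSquareL
import Literature.NumberTheory.LFunctions.Zhang2022.Section4Prop22Eventually
import HarnessLib

/-!
# Zhang (2022) §13 p. 75, `Z22:§13.u007`: the DISPLAYED IDENTITY of the (13.11)-example "by (2.34)" —
# the typed node `Typed.Section13.U007 c′` CLOSED BY NAME (row G-L3t6-3, note item; W14-R4)

Topic `Literature/NumberTheory/LFunctions/Zhang2022` (Landau–Siegel audit tree; verdict-neutral).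
Y. Zhang, *Discrete mean estimates and the Landau–Siegel zero*, arXiv:2211.02515v1 (2022)
[Zhang2022LandauSiegel] — **an unrefereed manuscript; the statements below are kernel theorems about one
of its displays TYPED AS PRINTED; nothing here asserts or denies its Theorems 1–2 or anything about
Landau–Siegel zeros.** ZHANG-L discharge lane, WP14, row G-L3t6-3 (booked on the (13.11)ᴿ derivation
`Typed.Section13.eq1311Rel_holds`, module `Section13Eq1311Holds`; this file is the row's remaining NOTE
item under ruling W14-R4: the example identity `U007`; the reconstructed shapes `U007a` / `U007b` / `U007c`
are theorems by name in `Section13ZeroSumBound` (`u007a_of_prop22`) and `Section13U007Closers`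
(`u007b_holds`, `u007c_of_prop22`, zl-w14-p6)).

§13 p. 75 (tex L3810–L3817) displays: "For example, by (2.34),
`Σ_{ψ∈Ψ₁}Σ_{ρ∈𝔷(ψ)} |L(ρ+β₁,ψ)/L′(ρ,ψ)| |L(ρ+β₂,ψ)|² ω(ρ)
 = −(1/2π) Σ_{ψ∈Ψ₁} (∫_{𝒥(α)} − ∫_{𝒥(−α)}) M(s+β₁,ψ)/M(s,ψ) · L(s+β₂,ψ)L(1−s−β₂,ψ̄) ω(s) ds + O(ε)`"
(`ε = e^{−c𝓛¹⁰}`, §4 p. 19), typed VERBATIM as `Typed.Section13.U007 c′` (`TypedSection13.lean`, with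
`−(1/2π)∫_{𝒥(z)} = −i·segInt_z` and the integrand `Typed.Section13.exIntegrand`).

**What is proved here** (0 new definitions, 0 new named facts; Assumption (A) unused):

* `u007_of_prop22 (hc′ : 0 ≤ c′) (h22 : Skeleton.Prop22 c′) : U007 c′` — with `c = 1/16`: per character
  this is the landed (2.34)/residue conversion `Typed.Section13.zeroSum_conversion_eq234_of_prop22`
  (module `Section13ZeroSumConversion`, zl-w14-p6: admissible rectangle, residue theorem, Lemma 5.9 on the
  contour from Prop. 2.2, the positive weight `|L(ρ+β₁)/L′(ρ)| = −iM(ρ+β₁)/M′(ρ)` of (2.34)) applied to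
  the holomorphic co-factor `H(s) = L(s+β₂,ψ)L(1−s−β₂,ψ̄)` — which equals `|L(ρ+β₂,ψ)|²` at the zeros
  (critical line, Prop. 2.2 (i); `LFunction_mul_refl_of_re_half`) and is `≤ (Z·P⁴)²` on the strip
  (`norm_LFunction_shift_le_bigP_pow_four`, `norm_LFunction_inv_reflect_shift_le_bigP_pow_four`,
  `Z = Σ n^{−5/4}`; `β₂ = iv₂`, `|v₂| ≤ 1` by `beta_small`) — summed over `#Ψ₁ ≤ 𝔓 ≤ 4P²` characters
  (`card_le_frakP`, `Skeleton.frakP_le_four_mul_bigP_sq`), with `4KZ²·P¹⁰·e^{−𝓛¹⁰/8} ≤ 4KZ²·e^{−𝓛¹⁰/16}`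
  for `𝓛 ≥ 160`.
* `u007_eventually : ∃ c₀ ≥ 0, ∀ c′ ≥ c₀, U007 c′` — Proposition 2.2 is a tree theorem for large `c′`
  (`Skeleton.prop22_eventually`).

With this file every typed `Z22:§13.u007` node (`U007`, `U007a`, `U007b`, `U007c`) is a theorem, next to
the (13.11) leaf `Skeleton.Eq1311Rel c′ c137` (`eq1311Rel_holds`). NOT here: (13.7) as printed (bypassed,
R-19), Theorems 1–2, zeros.

## References

* Y. Zhang, arXiv:2211.02515v1 (2022), §13 p. 75, tex L3810–L3817; §2 (2.34) p. 12, Prop. 2.2; §5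
  Lemma 5.9. [cite: Zhang2022LandauSiegel, §13 p.75 (last display)]
-/

noncomputable section

open Complex Real ComplexConjugate

namespace Literature.NumberTheory.LFunctions.Zhang2022.Typed.Section13

open Skeleton GammaFactor

/-! ## Sizes -/

/-- For `𝓛 ≥ 2`: `0 < α ≤ ½` (`α = π𝓛⁻⁹`). [cite: Zhang2022LandauSiegel, §2 (2.10)] -/
private theorem alpha_pos_le_half {D : ℕ} (hL : 2 ≤ ell D) : 0 < alpha D ∧ alpha D ≤ 1 / 2 := by
  have hL0 : 0 < ell D := by linarith
  have hα : alpha D = π / ell D ^ 9 := by rw [alpha, bigP, Real.log_exp]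
  have h9 : (8 : ℝ) ≤ ell D ^ 9 :=
    le_trans (by norm_num) (pow_le_pow_left₀ (by norm_num) hL 9)
  refine ⟨by rw [hα]; positivity, ?_⟩
  rw [hα, div_le_iff₀ (by positivity)]
  nlinarith [Real.pi_lt_four]

/-- **Absorption**: `P¹⁰·e^{−𝓛¹⁰/16} ≤ 1` for `𝓛 ≥ 160` (`P¹⁰ = e^{10𝓛⁹}`, `160𝓛⁹ ≤ 𝓛¹⁰`).
[cite: Zhang2022LandauSiegel, §2 (2.8)] -/
private theorem bigP_pow_ten_mul_exp_le_one {D : ℕ} (hL : 160 ≤ ell D) :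
    bigP D ^ 10 * Real.exp (-(1 / 16) * ell D ^ 10) ≤ 1 := by
  have hL0 : 0 ≤ ell D := by linarith
  have hP : bigP D ^ 10 = Real.exp (10 * ell D ^ 9) := by
    rw [bigP, ← Real.exp_nat_mul]; norm_num
  have h9 : 0 ≤ ell D ^ 9 := pow_nonneg hL0 9
  have hkey : 10 * ell D ^ 9 + -(1 / 16) * ell D ^ 10 ≤ 0 := by
    have : ell D ^ 10 = ell D ^ 9 * ell D := by ring
    rw [this]; nlinarith
  rw [hP, ← Real.exp_add]
  exact Real.exp_le_one_iff.mpr hkey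

/-! ## `U007` — the displayed identity "by (2.34)" -/

set_option maxHeartbeats 400000 in
/-- **`Z22:§13.u007`, the DISPLAYED IDENTITY — the typed node `Typed.Section13.U007 c′` from
Proposition 2.2, with `ε = e^{−𝓛¹⁰/16}`** (Z22 p. 75, tex L3810–L3817): for `c′ ≥ 0` with
`Skeleton.Prop22 c′`, for all large `D` and every real primitive `χ` with (A),
`‖ΣΣ_{ψ∈Ψ₁,ρ∈𝔷(ψ)} |L(ρ+β₁,ψ)/L′(ρ,ψ)|·|L(ρ+β₂,ψ)|²·ω(ρ)
 + i Σ_{ψ∈Ψ₁}(segInt_α − segInt_{−α})[M(s+β₁,ψ)/M(s,ψ)·L(s+β₂,ψ)L(1−s−β₂,ψ̄)·ω(s)]‖ ≤ C·e^{−𝓛¹⁰/16}`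
(`−(1/2π)∫_{𝒥(z)} = −i·segInt_z`). Per character this is the landed (2.34)/residue conversion
`zeroSum_conversion_eq234_of_prop22` for the holomorphic co-factor `H(s) = L(s+β₂,ψ)L(1−s−β₂,ψ̄)`, which
equals `|L(ρ+β₂,ψ)|²` at the zeros (critical line, Prop. 2.2 (i)) and is `≤ (Z·P⁴)²` on the strip;
summing over `#Ψ₁ ≤ 𝔓 ≤ 4P²` characters, `4KZ²·P¹⁰·e^{−𝓛¹⁰/8} ≤ 4KZ²·e^{−𝓛¹⁰/16}`.
[cite: Zhang2022LandauSiegel, §13 p.75 (last display); §2 (2.34) p.12] -/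
theorem u007_of_prop22 {c' : ℝ} (hc' : 0 ≤ c') (h22 : Prop22 c') : U007 c' := by
  obtain ⟨K, hK0, D₁, hconv⟩ := zeroSum_conversion_eq234_of_prop22 hc' h22
  obtain ⟨D₂, h22i⟩ := h22.1
  obtain ⟨D₃, hβ⟩ := beta_small c'
  obtain ⟨D₄, hP4⟩ := frakP_le_four_mul_bigP_sq
  obtain ⟨D₅, hℓ⟩ := exists_nat_forall_le_ell 160
  set Z : ℝ := ∑' n : ℕ, ((n + 1 : ℕ) : ℝ) ^ (-(5 / 4 : ℝ)) with hZ
  refine ⟨1 / 16, by norm_num, 4 * K * Z ^ 2, max (max D₁ D₂) (max D₃ (max D₄ D₅)),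
    fun D _ χ hD hq hp _ => ?_⟩
  have hD₁ : D₁ ≤ D := (le_max_left _ _).trans ((le_max_left _ _).trans hD)
  have hD₂ : D₂ ≤ D := (le_max_right _ _).trans ((le_max_left _ _).trans hD)
  have hD₃ : D₃ ≤ D := (le_max_left _ _).trans ((le_max_right _ _).trans hD)
  have hD₄ : D₄ ≤ D := (le_max_left _ _).trans ((le_max_right _ _).trans ((le_max_right _ _).trans hD))
  have hD₅ : D₅ ≤ D :=
    (le_max_right _ _).trans ((le_max_right _ _).trans ((le_max_right _ _).trans hD))
  have h160 : 160 ≤ ell D := hℓ D hD₅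
  have h80 : 80 ≤ ell D := by linarith
  have hL2 : 2 ≤ ell D := by linarith
  obtain ⟨_, hα2⟩ := alpha_pos_le_half hL2
  have hD3 : 3 ≤ D := by
    by_contra h
    have hD2 : (D : ℝ) ≤ 2 := by exact_mod_cast (by omega : D ≤ 2)
    have : ell D ≤ Real.log 2 := by
      rcases Nat.eq_zero_or_pos D with h0 | hpos
      · rw [ell, h0]; simp; exact Real.log_nonneg (by norm_num)
      · exact Real.log_le_log (by exact_mod_cast hpos) hD2
    linarith [Real.log_two_lt_d9]
  have hfrakP : frakP D ≤ 4 * bigP D ^ 2 := hP4 D hD₄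
  have hP0 : 0 ≤ frakP D := frakP_nonneg D
  -- `β₂ = iv₂`, `|v₂| ≤ 1`
  have hβre : (beta2 c' D).re = 0 := by simp [beta2]
  obtain ⟨v2, hv2⟩ : ∃ v2 : ℝ, beta2 c' D = (v2 : ℂ) * I :=
    ⟨2 * alpha D * (1 + c' * alpha D * ell D), by simp only [beta2]; push_cast; ring⟩
  have hv2abs : |v2| ≤ 1 := by
    have h := (hβ D hD₃).2.1
    rw [hv2, norm_mul, Complex.norm_I, mul_one, Complex.norm_real, Real.norm_eq_abs] at h
    exact h
  -- the co-factor `H(s) = L(s+β₂,ψ)L(1−s−β₂,ψ̄)`: holomorphic, bounded by `(Z·P⁴)²` on the strip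
  set Hmax : ℝ := (Z * bigP D ^ 4) ^ 2 with hHm
  have hHmax0 : 0 ≤ Hmax := sq_nonneg _
  have hHdiff : ∀ x : Chr D, ∀ z : ℂ, 0 < z.im →
      DifferentiableAt ℂ
        (fun s => x.ψ.LFunction (s + beta2 c' D) * x.ψ⁻¹.LFunction (1 - s - beta2 c' D)) z := by
    intro x z _
    have hne : x.ψ ≠ 1 := x.ψ_ne_one
    have hne' : x.ψ⁻¹ ≠ 1 := inv_ne_one.mpr hne
    have h1 : DifferentiableAt ℂ (fun s => x.ψ.LFunction (s + beta2 c' D)) z :=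
      ((DirichletCharacter.differentiable_LFunction hne).comp
        (differentiable_id.add (differentiable_const _))) z
    have h2 : DifferentiableAt ℂ (fun s => x.ψ⁻¹.LFunction (1 - s - beta2 c' D)) z :=
      ((DirichletCharacter.differentiable_LFunction hne').comp
        ((differentiable_const _ |>.sub differentiable_id).sub (differentiable_const _))) z
    exact h1.mul h2
  have hHb : ∀ x : Chr D, ∀ s : ℂ, |s.re - 1 / 2| ≤ alpha D → |s.im - 2 * π * t0 D| ≤ ell1 D + 1 →
      ‖x.ψ.LFunction (s + beta2 c' D) * x.ψ⁻¹.LFunction (1 - s - beta2 c' D)‖ ≤ Hmax := by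
    intro x s hσ hτ
    have hσ' : |s.re - 1 / 2| ≤ 1 / 2 := hσ.trans hα2
    rw [hv2, norm_mul]
    have hA := norm_LFunction_shift_le_bigP_pow_four h80 x hv2abs hσ' hτ
    have hB := norm_LFunction_inv_reflect_shift_le_bigP_pow_four h80 x hv2abs hσ' hτ
    rw [← hZ] at hA hB
    have hZP : 0 ≤ Z * bigP D ^ 4 := le_trans (norm_nonneg _) hA
    rw [hHm, sq]
    exact mul_le_mul hA hB (norm_nonneg _) hZP
  -- per character: the conversion identity, with `H(ρ) = |L(ρ+β₂)|²` at the critical zeros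
  set T := finsetOf (PsiOne χ) with hT
  have key : ∀ x ∈ T,
      ‖(∑ ρ ∈ finsetOf (zeroSet D x),
          ((‖x.ψ.LFunction (ρ + beta1 c' D) / deriv x.ψ.LFunction ρ‖ *
              ‖x.ψ.LFunction (ρ + beta2 c' D)‖ ^ 2 : ℝ) : ℂ) * omegaW D ρ) +
        I * (Lemma81.segInt (t0 D) (ell1 D) ((alpha D : ℝ) : ℂ) (exIntegrand c' x) -
          Lemma81.segInt (t0 D) (ell1 D) ((-alpha D : ℝ) : ℂ) (exIntegrand c' x))‖ ≤
        K * Hmax * Real.exp (-(ell D ^ 10 / 8)) := by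
    intro x hxT
    have hxΨ : x ∈ PsiOne χ := mem_of_mem_finsetOf hxT
    have h := hconv D χ hD₁ hq hp x hxΨ
      (fun s => x.ψ.LFunction (s + beta2 c' D) * x.ψ⁻¹.LFunction (1 - s - beta2 c' D))
      Hmax hHmax0 (hHdiff x) (hHb x)
    have hfin : (zeroSet D x).Finite := zerosFinite_holds D x
    have hA : (∑ ρ ∈ finsetOf (zeroSet D x),
        ((‖x.ψ.LFunction (ρ + beta1 c' D) / deriv x.ψ.LFunction ρ‖ *
            ‖x.ψ.LFunction (ρ + beta2 c' D)‖ ^ 2 : ℝ) : ℂ) * omegaW D ρ) =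
        ∑ ρ ∈ finsetOf (zeroSet D x),
          ((‖x.ψ.LFunction (ρ + beta1 c' D) / deriv x.ψ.LFunction ρ‖ : ℝ) : ℂ) *
            (x.ψ.LFunction (ρ + beta2 c' D) * x.ψ⁻¹.LFunction (1 - ρ - beta2 c' D)) *
              omegaW D ρ := by
      refine Finset.sum_congr rfl fun ρ hρ => ?_
      have hρz : ρ ∈ zeroSet D x := (mem_finsetOf hfin).mp hρ
      have hre : ρ.re = 1 / 2 :=
        h22i D χ hD₂ hq hp x hxΨ ρ (mem_prodZeroSetOmega_of_mem_zeroSet χ hρz)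
      rw [LFunction_mul_refl_of_re_half x hβre hre]
      push_cast
      ring
    rw [hA]
    exact h
  -- sum over `Ψ₁`
  have hsplit : (∑ i ∈ idx χ,
        ((‖i.1.ψ.LFunction (i.2 + beta1 c' D) / deriv i.1.ψ.LFunction i.2‖ *
            ‖i.1.ψ.LFunction (i.2 + beta2 c' D)‖ ^ 2 : ℝ) : ℂ) * omegaW D i.2) -
        (-I * ∑ x ∈ T,
          (Lemma81.segInt (t0 D) (ell1 D) ((alpha D : ℝ) : ℂ) (exIntegrand c' x) -
            Lemma81.segInt (t0 D) (ell1 D) ((-alpha D : ℝ) : ℂ) (exIntegrand c' x))) =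
      ∑ x ∈ T, ((∑ ρ ∈ finsetOf (zeroSet D x),
          ((‖x.ψ.LFunction (ρ + beta1 c' D) / deriv x.ψ.LFunction ρ‖ *
              ‖x.ψ.LFunction (ρ + beta2 c' D)‖ ^ 2 : ℝ) : ℂ) * omegaW D ρ) +
        I * (Lemma81.segInt (t0 D) (ell1 D) ((alpha D : ℝ) : ℂ) (exIntegrand c' x) -
          Lemma81.segInt (t0 D) (ell1 D) ((-alpha D : ℝ) : ℂ) (exIntegrand c' x))) := by
    rw [hT, idx, Finset.sum_sigma, neg_mul, sub_neg_eq_add, Finset.mul_sum, ← Finset.sum_add_distrib]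
  have hcard : (T.card : ℝ) ≤ frakP D := card_le_frakP T
  have hexp : Real.exp (-(ell D ^ 10 / 8)) =
      Real.exp (-(1 / 16) * ell D ^ 10) * Real.exp (-(1 / 16) * ell D ^ 10) := by
    rw [← Real.exp_add]; ring_nf
  have habs : bigP D ^ 10 * Real.exp (-(1 / 16) * ell D ^ 10) ≤ 1 := bigP_pow_ten_mul_exp_le_one h160
  have hZ0 : 0 ≤ Z := tsum_nonneg fun n => Real.rpow_nonneg (Nat.cast_nonneg _) _
  have hε0 : 0 ≤ Real.exp (-(1 / 16) * ell D ^ 10) := (Real.exp_pos _).le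
  have hbigP0 : 0 ≤ bigP D := (Real.exp_pos _).le
  rw [hsplit]
  calc ‖∑ x ∈ T, ((∑ ρ ∈ finsetOf (zeroSet D x),
          ((‖x.ψ.LFunction (ρ + beta1 c' D) / deriv x.ψ.LFunction ρ‖ *
              ‖x.ψ.LFunction (ρ + beta2 c' D)‖ ^ 2 : ℝ) : ℂ) * omegaW D ρ) +
        I * (Lemma81.segInt (t0 D) (ell1 D) ((alpha D : ℝ) : ℂ) (exIntegrand c' x) -
          Lemma81.segInt (t0 D) (ell1 D) ((-alpha D : ℝ) : ℂ) (exIntegrand c' x)))‖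
      ≤ ∑ x ∈ T, ‖(∑ ρ ∈ finsetOf (zeroSet D x),
          ((‖x.ψ.LFunction (ρ + beta1 c' D) / deriv x.ψ.LFunction ρ‖ *
              ‖x.ψ.LFunction (ρ + beta2 c' D)‖ ^ 2 : ℝ) : ℂ) * omegaW D ρ) +
        I * (Lemma81.segInt (t0 D) (ell1 D) ((alpha D : ℝ) : ℂ) (exIntegrand c' x) -
          Lemma81.segInt (t0 D) (ell1 D) ((-alpha D : ℝ) : ℂ) (exIntegrand c' x))‖ :=
        norm_sum_le _ _
    _ ≤ ∑ x ∈ T, K * Hmax * Real.exp (-(ell D ^ 10 / 8)) := Finset.sum_le_sum key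
    _ = T.card * (K * Hmax * Real.exp (-(ell D ^ 10 / 8))) := by
        rw [Finset.sum_const, nsmul_eq_mul]
    _ ≤ frakP D * (K * Hmax * Real.exp (-(ell D ^ 10 / 8))) :=
        mul_le_mul_of_nonneg_right hcard (by positivity)
    _ ≤ 4 * bigP D ^ 2 * (K * Hmax * Real.exp (-(ell D ^ 10 / 8))) :=
        mul_le_mul_of_nonneg_right hfrakP (by positivity)
    _ = 4 * K * Z ^ 2 * (bigP D ^ 10 * Real.exp (-(1 / 16) * ell D ^ 10)) *
          Real.exp (-(1 / 16) * ell D ^ 10) := by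
        rw [hexp, hHm]; ring
    _ ≤ 4 * K * Z ^ 2 * 1 * Real.exp (-(1 / 16) * ell D ^ 10) := by gcongr
    _ = 4 * K * Z ^ 2 * Real.exp (-(1 / 16) * ell D ^ 10) := by ring

/-- **`U007 c′` for every sufficiently large `c′`, NO hypothesis** (`Skeleton.prop22_eventually`).
[cite: Zhang2022LandauSiegel, §13 p.75 (last display); §2 Prop. 2.2] -/
theorem u007_eventually : ∃ c₀ : ℝ, 0 ≤ c₀ ∧ ∀ c' : ℝ, c₀ ≤ c' → U007 c' := by
  obtain ⟨c₀, hc₀, h⟩ := prop22_eventually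
  exact ⟨c₀, hc₀, fun c' hc' => u007_of_prop22 (hc₀.trans hc') (h c' hc')⟩

end Literature.NumberTheory.LFunctions.Zhang2022.Typed.Section13
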